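import Literature.AnabelianGeometry.EtaleTheta.Discharge.Sec1Prop15iiiZLawOfGenerators
import Literature.AnabelianGeometry.EtaleTheta.KummerDataOfCoreConj
import HarnessLib

/-!
# [EtTh] Prop. 1.5 (iii) at the Kummer data of a KUMMER CORE: the typed predicate from the two printed
# displays AT ONE GENERATOR of `Z` (all Kummer-side inputs discharged; proof-only)

S. Mochizuki, *The étale theta function and its Frobenioid-theoretic manifestations*, Publ. RIMS **45**
(2009) [EtTh], §1, Prop. 1.5 (iii), PRIMS PDF p. 23 (printed 249): "Any class `η̈^Θ ∈ H¹(Π^tp_Ÿ, Δ_Θ)`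
arises from a unique class `η̈^Θ ∈ H¹((Π^tp_Ÿ)^Θ, Δ_Θ)` that maps to `log(Θ)` in the quotient `F̈⁰/F̈¹` and
on which `a ∈ Z` acts as follows: `η̈^Θ ↦ η̈^Θ − 2a·log(Ü) − (a²/2)·log(q_X) + log(O^×_K̈)`"
[cite: MochizukiEtTh2009, Prop 1.5 (iii) p.23]. Layer L2 of the abc-iut cell, seat abc-iut-L2-t12 (gen 5),
ROW R184 «Prop 1.5 (iii) FACT → THEOREM», capstone of D1 (`ZLawOfGenerators`,
`Discharge/Sec1Prop15iiiZLawOfGenerators`) + D2 (`KummerDataOfCoreConj`) over abc-iut-L2-t6's one-lift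
reduction (`Discharge/Sec1Prop15iiiOfLift`) and abc-iut-w5-d171's / abc-iut-L2-t6's Kummer data of a Kummer
core (`KummerCore.toKummerData`, `KummerCore.toKummerDataOfSection`). PROOF-ONLY, consumed BY NAME.

RESULT. For ANY theta setting `D` with `hC : D.Compat`, ANY Kummer core `C` and ANY class `η ∈ H¹(Π^tp_Ÿ, Δ_Θ)`,
the typed `ThetaSetting.Prop15iii` holds for the étale-theta datum `etaleThetaDataOfClass _ η` over the core's
Kummer data (resp. over the section datum) AS SOON AS: `η` has a lift `x′` to `(Π^tp_Ÿ)^Θ` restricting to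
`log(Θ)` on `Δ_Θ`, and the two printed displays hold AT ONE `σ₀` with `toZ σ₀ = 1` and on `Π^tp_Y`:
`σ₀·log(Ü) = log(Ü)·κ(q̈)·κ(u)`, `y·log(Ü) ∈ log(Ü)·κ(O^×)`; `σ₀·x′ = x′·log(Ü)^{−2}·κ(q̈)^{−1}·κ(u)`,
`y·x′ ∈ x′·κ(O^×)` (`Π^tp_Ÿ` acts trivially, `conj_eq_self_of_mem_GtpYdd`, so only `Π^tp_Y/Π^tp_Ÿ`-representatives
matter). The Kummer-side inputs — unit classes permuted (`conj_kumYdd_units`), `σ·κ(q̈) = κ(q̈)κ(±1)`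
(`conj_kumYdd_qddUnit`), unit classes die on `Δ_Θ` (`res_deltaTheta_kumYdd_units`) — are THEOREMS (D2).
What remains as binders is exactly the geometric content of print's proof ("follows from Propositions 1.3;
1.4, (ii), (iii)": the functional equation `Θ̈(q_X^{1/2}Ü) = −q_X^{−1/2}Ü^{−2}Θ̈(Ü)` read on classes at the
deck generator, and `Ü ↦ q̈·Ü`). HONEST FRAMING: reductions over the semi-synthetic interface; nothing of
[EtTh] is asserted; typed ≠ proved; no side is taken on [IUTchIII] Cor. 3.12.
-/

noncomputable section

namespace Literature.AnabelianGeometry.EtaleTheta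

open Literature.AnabelianGeometry.SemiGraphs

namespace ThetaSetting


namespace KummerData

variable {p : ℕ} [Fact p.Prime] {D : ThetaSetting p} (E : D.KummerData)

/-- **The `Π^tp_Y`-binders reduce to generators modulo `Π^tp_Ÿ`**: if conjugation moves `z` by unit classes
on a set `S` with `Π^tp_Y ≤ ⟨S ∪ Π^tp_Ÿ⟩`, then it does so on all of `Π^tp_Y` (`Π^tp_Ÿ` acts trivially; the unit
law is closed under products and inverses, `ZLaw.unitLaw_closure`). Serves the binders `hLY`/`hxY` below.
[cite: MochizukiEtTh2009, Prop 1.5 (iii) p.23] -/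
theorem unitLaw_GtpY_of_generators (hC : D.Compat) (z : D.H1Theta (D.GtpYdd.map D.toTheta))
    (hU : haveI := hC.GtpYddTheta_normal
      ∀ σ : D.PiTemp, ∀ u ∈ D.unitsOKdd, ∃ u' ∈ D.unitsOKdd,
        ContH1.conj (MonoidHom.id D.GtpTheta) D.DeltaTheta (D.toTheta σ) (E.kumYdd (E.toKddHat u)) =
          E.kumYdd (E.toKddHat u'))
    (S : Set D.PiTemp) (hgen : D.GtpY ≤ Subgroup.closure (S ∪ (D.GtpYdd : Set D.PiTemp)))
    (hS : haveI := hC.GtpYddTheta_normal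
      ∀ s ∈ S, ∃ u ∈ D.unitsOKdd,
        ContH1.conj (MonoidHom.id D.GtpTheta) D.DeltaTheta (D.toTheta s) z = z * E.kumYdd (E.toKddHat u)) :
    haveI := hC.GtpYddTheta_normal
    ∀ y ∈ D.GtpY, ∃ u ∈ D.unitsOKdd,
      ContH1.conj (MonoidHom.id D.GtpTheta) D.DeltaTheta (D.toTheta y) z = z * E.kumYdd (E.toKddHat u) := by
  haveI := hC.GtpYddTheta_normal
  intro y hy
  refine ZLaw.unitLaw_closure
    (ρ := fun σ => ContH1.conj (MonoidHom.id D.GtpTheta) D.DeltaTheta (D.toTheta σ))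
    (κ := E.kumYdd.comp E.toKddHat) (V₀ := D.unitsOKdd) (x := z)
    (conj_toTheta_one hC) (conj_toTheta_mul hC) hU ?_ y (hgen hy)
  rintro s (hs | hs)
  · exact hS s hs
  · exact ⟨1, D.unitsOKdd.one_mem, by
      rw [conj_eq_self_of_mem_GtpYdd hC hs, MonoidHom.comp_apply, map_one, map_one, mul_one]⟩

end KummerData

namespace KummerCore

variable {p : ℕ} [Fact p.Prime] {D : ThetaSetting p} (C : D.KummerCore)

/-- **Prop. 1.5 (iii) over a Kummer core, from the displays at one generator.**
[cite: MochizukiEtTh2009, Prop 1.5 (iii) p.23] -/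
theorem prop15iii_etaleThetaDataOfClass_of_generator (hC : D.Compat) (η : D.H1 D.GtpYdd)
    (x' : D.H1Theta (D.GtpYdd.map D.toTheta)) (hx' : D.inflTheta D.GtpYdd x' = η)
    (hres : ContH1.res (MonoidHom.id D.GtpTheta) D.DeltaTheta
      (hC.deltaTheta_le_DtpYddTheta.trans (Subgroup.map_mono inf_le_left)) x' = D.logTheta)
    {σ₀ : D.PiTemp} (hσ₀ : D.toZ σ₀ = Multiplicative.ofAdd 1)
    (hL₀ : haveI := hC.GtpYddTheta_normal
      ∃ u ∈ D.unitsOKdd, ContH1.conj (MonoidHom.id D.GtpTheta) D.DeltaTheta (D.toTheta σ₀) C.logUdd =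
        C.logUdd * C.toKummerData.kumYdd (C.toKummerData.toKddHat D.qddUnit) *
          C.toKummerData.kumYdd (C.toKummerData.toKddHat u))
    (hLY : haveI := hC.GtpYddTheta_normal
      ∀ y ∈ D.GtpY, ∃ u ∈ D.unitsOKdd,
        ContH1.conj (MonoidHom.id D.GtpTheta) D.DeltaTheta (D.toTheta y) C.logUdd =
          C.logUdd * C.toKummerData.kumYdd (C.toKummerData.toKddHat u))
    (hx₀ : haveI := hC.GtpYddTheta_normal
      ∃ u ∈ D.unitsOKdd, ContH1.conj (MonoidHom.id D.GtpTheta) D.DeltaTheta (D.toTheta σ₀) x' =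
        x' * C.logUdd ^ (-(2 : ℤ)) * C.toKummerData.kumYdd (C.toKummerData.toKddHat D.qddUnit) ^ (-(1 : ℤ)) *
          C.toKummerData.kumYdd (C.toKummerData.toKddHat u))
    (hxY : haveI := hC.GtpYddTheta_normal
      ∀ y ∈ D.GtpY, ∃ u ∈ D.unitsOKdd,
        ContH1.conj (MonoidHom.id D.GtpTheta) D.DeltaTheta (D.toTheta y) x' =
          x' * C.toKummerData.kumYdd (C.toKummerData.toKddHat u)) :
    Prop15iii (C.toKummerData.etaleThetaDataOfClass η) hC :=
  C.toKummerData.prop15iii_etaleThetaDataOfClass_of_generator hC η x' hx' hres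
    (C.res_deltaTheta_kumYdd_units hC) (C.conj_kumYdd_units hC) (C.conj_kumYdd_qddUnit hC)
    hσ₀ hL₀ hLY hx₀ hxY

/-- **The `Z`-action display for all `σ`** over a Kummer core, from the displays at one generator (the
binder `hconj` of the one-lift reductions). [cite: MochizukiEtTh2009, Prop 1.5 (iii) p.23] -/
theorem zLaw_of_generator (hC : D.Compat) (x' : D.H1Theta (D.GtpYdd.map D.toTheta))
    {σ₀ : D.PiTemp} (hσ₀ : D.toZ σ₀ = Multiplicative.ofAdd 1)
    (hL₀ : haveI := hC.GtpYddTheta_normal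
      ∃ u ∈ D.unitsOKdd, ContH1.conj (MonoidHom.id D.GtpTheta) D.DeltaTheta (D.toTheta σ₀) C.logUdd =
        C.logUdd * C.toKummerData.kumYdd (C.toKummerData.toKddHat D.qddUnit) *
          C.toKummerData.kumYdd (C.toKummerData.toKddHat u))
    (hLY : haveI := hC.GtpYddTheta_normal
      ∀ y ∈ D.GtpY, ∃ u ∈ D.unitsOKdd,
        ContH1.conj (MonoidHom.id D.GtpTheta) D.DeltaTheta (D.toTheta y) C.logUdd =
          C.logUdd * C.toKummerData.kumYdd (C.toKummerData.toKddHat u))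
    (hx₀ : haveI := hC.GtpYddTheta_normal
      ∃ u ∈ D.unitsOKdd, ContH1.conj (MonoidHom.id D.GtpTheta) D.DeltaTheta (D.toTheta σ₀) x' =
        x' * C.logUdd ^ (-(2 : ℤ)) * C.toKummerData.kumYdd (C.toKummerData.toKddHat D.qddUnit) ^ (-(1 : ℤ)) *
          C.toKummerData.kumYdd (C.toKummerData.toKddHat u))
    (hxY : haveI := hC.GtpYddTheta_normal
      ∀ y ∈ D.GtpY, ∃ u ∈ D.unitsOKdd,
        ContH1.conj (MonoidHom.id D.GtpTheta) D.DeltaTheta (D.toTheta y) x' =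
          x' * C.toKummerData.kumYdd (C.toKummerData.toKddHat u)) :
    haveI := hC.GtpYddTheta_normal
    ∀ σ : D.PiTemp, ∃ u ∈ D.unitsOKdd,
      ContH1.conj (MonoidHom.id D.GtpTheta) D.DeltaTheta (D.toTheta σ) x' =
        x' * C.logUdd ^ (-(2 * Multiplicative.toAdd (D.toZ σ)))
           * C.toKummerData.kumYdd (C.toKummerData.toKddHat D.qddUnit) ^
              (-(Multiplicative.toAdd (D.toZ σ) * Multiplicative.toAdd (D.toZ σ)))
           * C.toKummerData.kumYdd (C.toKummerData.toKddHat u) :=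
  C.toKummerData.zLaw_of_generator' hC x' (C.conj_kumYdd_units hC) (C.conj_kumYdd_qddUnit hC)
    hσ₀ hL₀ hLY hx₀ hxY

/-! ### At the section datum -/

section OfSection

variable (s : GQp p →* D.PiTemp) (hs : Continuous s) (hsec : ∀ σ : GQp p, D.aug (s σ) = σ)
  (hsY : D.GK.map s ≤ D.GtpY) (hsYdd : D.GKdd.map s ≤ D.GtpYdd)

/-- **Prop. 1.5 (iii) over the SECTION datum** (`KddHat := H¹(G_K̈, Δ_Θ)`, the carrier on which points
of `Ÿ` are evaluated), from the displays at one generator. [cite: MochizukiEtTh2009, Prop 1.5 (iii) p.23] -/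
theorem prop15iii_etaleThetaDataOfClass_ofSection_of_generator (hC : D.Compat) (η : D.H1 D.GtpYdd)
    (x' : D.H1Theta (D.GtpYdd.map D.toTheta)) (hx' : D.inflTheta D.GtpYdd x' = η)
    (hres : ContH1.res (MonoidHom.id D.GtpTheta) D.DeltaTheta
      (hC.deltaTheta_le_DtpYddTheta.trans (Subgroup.map_mono inf_le_left)) x' = D.logTheta)
    {σ₀ : D.PiTemp} (hσ₀ : D.toZ σ₀ = Multiplicative.ofAdd 1)
    (hL₀ : haveI := hC.GtpYddTheta_normal
      ∃ u ∈ D.unitsOKdd, ContH1.conj (MonoidHom.id D.GtpTheta) D.DeltaTheta (D.toTheta σ₀) C.logUdd =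
        C.logUdd * (C.toKummerDataOfSection s hs hsec hsY hsYdd).kumYdd
            ((C.toKummerDataOfSection s hs hsec hsY hsYdd).toKddHat D.qddUnit) *
          (C.toKummerDataOfSection s hs hsec hsY hsYdd).kumYdd
            ((C.toKummerDataOfSection s hs hsec hsY hsYdd).toKddHat u))
    (hLY : haveI := hC.GtpYddTheta_normal
      ∀ y ∈ D.GtpY, ∃ u ∈ D.unitsOKdd,
        ContH1.conj (MonoidHom.id D.GtpTheta) D.DeltaTheta (D.toTheta y) C.logUdd =
          C.logUdd * (C.toKummerDataOfSection s hs hsec hsY hsYdd).kumYdd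
            ((C.toKummerDataOfSection s hs hsec hsY hsYdd).toKddHat u))
    (hx₀ : haveI := hC.GtpYddTheta_normal
      ∃ u ∈ D.unitsOKdd, ContH1.conj (MonoidHom.id D.GtpTheta) D.DeltaTheta (D.toTheta σ₀) x' =
        x' * C.logUdd ^ (-(2 : ℤ)) * (C.toKummerDataOfSection s hs hsec hsY hsYdd).kumYdd
            ((C.toKummerDataOfSection s hs hsec hsY hsYdd).toKddHat D.qddUnit) ^ (-(1 : ℤ)) *
          (C.toKummerDataOfSection s hs hsec hsY hsYdd).kumYdd
            ((C.toKummerDataOfSection s hs hsec hsY hsYdd).toKddHat u))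
    (hxY : haveI := hC.GtpYddTheta_normal
      ∀ y ∈ D.GtpY, ∃ u ∈ D.unitsOKdd,
        ContH1.conj (MonoidHom.id D.GtpTheta) D.DeltaTheta (D.toTheta y) x' =
          x' * (C.toKummerDataOfSection s hs hsec hsY hsYdd).kumYdd
            ((C.toKummerDataOfSection s hs hsec hsY hsYdd).toKddHat u)) :
    Prop15iii ((C.toKummerDataOfSection s hs hsec hsY hsYdd).etaleThetaDataOfClass η) hC :=
  (C.toKummerDataOfSection s hs hsec hsY hsYdd).prop15iii_etaleThetaDataOfClass_of_generator hC η x' hx' hres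
    (fun _ _ => C.res_deltaTheta_kumYdd_ofSection s hs hsec hsY hsYdd hC _)
    (C.conj_kumYdd_units_ofSection s hs hsec hsY hsYdd hC)
    (C.conj_kumYdd_qddUnit_ofSection s hs hsec hsY hsYdd hC) hσ₀ hL₀ hLY hx₀ hxY

end OfSection

end KummerCore

end ThetaSetting

end Literature.AnabelianGeometry.EtaleTheta

end
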